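import Mathlib.Analysis.InnerProductSpace.PiL2
import Mathlib.Analysis.InnerProductSpace.Calculus
import Mathlib.Analysis.Calculus.FDeriv.Add
import Mathlib.Analysis.Calculus.Deriv.Comp
import Mathlib.Analysis.Calculus.LineDeriv.Basic
import Mathlib.Tactic.Module
import HarnessLib

/-!
# Stub Z4 `stub_defect_translate` for crux `MoebiusLimitExists` (stmt-CriticalPhenomena-1344), line `Sketch` v16
(lead prover-line-stmt-CriticalPhenomena-1344-c19-0; THEOREM-ONLY, `--supports stmt-CriticalPhenomena-1344`)

**The pointwise special-conformal defect is translation invariant.**  For one level `F : (ℝ³)ⁿ → ℝ`, a weight `Δ`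
and a generator `b ∈ ℝ³`, the pointwise SCT defect is
`E_b(F)(x) := DF(x)[(‖xᵢ‖² b − 2⟪b,xᵢ⟫ xᵢ)ᵢ] − 2Δ (Σᵢ ⟪b,xᵢ⟫) F(x)`.
If `F` is translation invariant, differentiable at `x`, satisfies at `x` the Euler identity `DF(x)[x] = −nΔ F(x)` and is
annihilated at `x` by the rotation generators `(⟪c,xᵢ⟫ b − ⟪b,xᵢ⟫ c)ᵢ`, then `E_b(F)(x + ĉ) = E_b(F)(x)` for every
`c ∈ ℝ³` (`ĉ = (c, …, c)`).  This is the conformal-algebra relation `[P_a, K_b] = 2δ_{ab} D − 2 M_{ab}`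
(Di Francesco–Mathieu–Sénéchal, *Conformal Field Theory* (1997), §4.1 (4.19)) read on the defect.

Proof: pointwise `K_b(xᵢ + c) = K_b(xᵢ) + 2(⟪c,xᵢ⟫ b − ⟪b,xᵢ⟫ c) − 2⟪b,c⟫ xᵢ + (‖c‖² b − 2⟪b,c⟫ c)`; translation
invariance gives `DF(x + ĉ) = DF(x)`, `F(x + ĉ) = F(x)` and kills the constant field; the rotation generators kill the
second term; the third is cancelled against `2Δ · n⟪b,c⟫ F(x)` by the Euler identity.  Pure finite-dimensional calculus,
Mathlib only; no definitions are introduced.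
-/

noncomputable section

open scoped BigOperators

namespace Summit.CriticalPhenomena.Ising3DConformalLimit.MoebiusLimitExistsSketchV16

/-- Pointwise expansion of the special-conformal vector field under a translation:
`‖y + c‖² b − 2⟪b, y + c⟫ (y + c) = (‖y‖² b − 2⟪b,y⟫ y) + 2 (⟪c,y⟫ b − ⟪b,y⟫ c) − 2⟪b,c⟫ y + (‖c‖² b − 2⟪b,c⟫ c)`.
[folklore] -/
theorem sctField_add_const (b c y : EuclideanSpace ℝ (Fin 3)) :
    ‖y + c‖ ^ 2 • b - (2 * inner ℝ b (y + c)) • (y + c) =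
      (‖y‖ ^ 2 • b - (2 * inner ℝ b y) • y) + (2 : ℝ) • (inner ℝ c y • b - inner ℝ b y • c)
        + (-(2 * inner ℝ b c)) • y + (‖c‖ ^ 2 • b - (2 * inner ℝ b c) • c) := by
  rw [norm_add_sq_real, inner_add_right, real_inner_comm c y]
  module

/-- Configuration-space form of `sctField_add_const`: the special-conformal configuration field at `x + ĉ` is the field at
`x` plus twice the rotation generator `(⟪c,xᵢ⟫ b − ⟪b,xᵢ⟫ c)ᵢ`, minus `2⟪b,c⟫ x`, plus a constant field. [folklore] -/
theorem sctConfigField_add_const {n : ℕ} (b c : EuclideanSpace ℝ (Fin 3)) (x : Fin n → EuclideanSpace ℝ (Fin 3)) :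
    (fun i => ‖x i + c‖ ^ 2 • b - (2 * inner ℝ b (x i + c)) • (x i + c)) =
      (fun i => ‖x i‖ ^ 2 • b - (2 * inner ℝ b (x i)) • x i)
        + (2 : ℝ) • (fun i => inner ℝ c (x i) • b - inner ℝ b (x i) • c)
        + (-(2 * inner ℝ b c)) • x + (fun _ => ‖c‖ ^ 2 • b - (2 * inner ℝ b c) • c) := by
  funext i
  simp only [Pi.add_apply, Pi.smul_apply]
  exact sctField_add_const b c (x i)

/-- For a translation-invariant `F : (ℝ³)ⁿ → ℝ`, the Fréchet derivative is translation invariant: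
`DF(x + ĉ) = DF(x)` (chain rule for `F ∘ (· + ĉ) = F`; no differentiability needed, both sides being `0` otherwise).
[folklore] -/
theorem fderiv_translate_of_invariant {n : ℕ} (F : (Fin n → EuclideanSpace ℝ (Fin 3)) → ℝ)
    (hT : ∀ (v : EuclideanSpace ℝ (Fin 3)) (y : Fin n → EuclideanSpace ℝ (Fin 3)), F (fun i => y i + v) = F y)
    (x : Fin n → EuclideanSpace ℝ (Fin 3)) (c : EuclideanSpace ℝ (Fin 3)) :
    fderiv ℝ F (fun i => x i + c) = fderiv ℝ F x := by
  have h1 : (fun y : Fin n → EuclideanSpace ℝ (Fin 3) => F (y + fun _ => c)) = F :=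
    funext fun y => hT c y
  have h2 := fderiv_comp_add_right (𝕜 := ℝ) (f := F) (x := x) (fun _ : Fin n => c)
  rw [h1] at h2
  exact h2.symm

/-- For a translation-invariant `F : (ℝ³)ⁿ → ℝ` differentiable at `x`, the derivative kills every constant field:
`DF(x)[(w, …, w)] = 0` (the restriction of `F` to the line `t ↦ x + t ŵ` is constant). [folklore] -/
theorem fderiv_apply_const_of_invariant {n : ℕ} (F : (Fin n → EuclideanSpace ℝ (Fin 3)) → ℝ)
    (x : Fin n → EuclideanSpace ℝ (Fin 3)) (hF : DifferentiableAt ℝ F x)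
    (hT : ∀ (v : EuclideanSpace ℝ (Fin 3)) (y : Fin n → EuclideanSpace ℝ (Fin 3)), F (fun i => y i + v) = F y)
    (w : EuclideanSpace ℝ (Fin 3)) :
    fderiv ℝ F x (fun _ => w) = 0 := by
  have hlin : HasDerivAt (fun t : ℝ => F (x + t • fun _ : Fin n => w)) (fderiv ℝ F x fun _ => w) 0 :=
    hF.hasFDerivAt.hasLineDerivAt _
  have hconst : (fun t : ℝ => F (x + t • fun _ : Fin n => w)) = fun _ => F x := by
    funext t
    change F (fun i => x i + t • w) = F x
    exact hT (t • w) x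
  rw [hconst] at hlin
  exact hlin.unique (hasDerivAt_const (0 : ℝ) (F x))

/-- **Stub Z4 — the special-conformal defect is translation invariant.**  For a translation-invariant level
`F : (ℝ³)ⁿ → ℝ` differentiable at `x`, satisfying at `x` the Euler identity `DF(x)[x] = −nΔ F(x)` and annihilated at `x`
by the rotation generators, `E_b(F)(x + ĉ) = E_b(F)(x)` for every `b c ∈ ℝ³`, where
`E_b(F)(x) = DF(x)[(‖xᵢ‖² b − 2⟪b,xᵢ⟫ xᵢ)ᵢ] − 2Δ (Σᵢ⟪b,xᵢ⟫) F(x)` — the conformal-algebra relation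
`[P_a, K_b] = 2δ_{ab} D − 2M_{ab}` (Di Francesco–Mathieu–Sénéchal 1997, §4.1 (4.19)) read on the defect. [folklore] -/
theorem stub_defect_translate : ∀ (n : ℕ) (F : (Fin n → EuclideanSpace ℝ (Fin 3)) → ℝ) (Δ : ℝ)
    (x : Fin n → EuclideanSpace ℝ (Fin 3)), DifferentiableAt ℝ F x →
    (∀ (v : EuclideanSpace ℝ (Fin 3)) (y : Fin n → EuclideanSpace ℝ (Fin 3)), F (fun i => y i + v) = F y) →
    fderiv ℝ F x x = -(n * Δ) * F x →
    (∀ b c : EuclideanSpace ℝ (Fin 3), fderiv ℝ F x (fun i => inner ℝ c (x i) • b - inner ℝ b (x i) • c) = 0) →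
    ∀ (b c : EuclideanSpace ℝ (Fin 3)),
    fderiv ℝ F (fun i => x i + c) (fun i => ‖x i + c‖ ^ 2 • b - (2 * inner ℝ b (x i + c)) • (x i + c)) -
        2 * Δ * (∑ i, inner ℝ b (x i + c)) * F (fun i => x i + c) =
      fderiv ℝ F x (fun i => ‖x i‖ ^ 2 • b - (2 * inner ℝ b (x i)) • x i) - 2 * Δ * (∑ i, inner ℝ b (x i)) * F x := by
  intro n F Δ x hF hT hE hR b c
  have hsum : ∑ i, inner ℝ b (x i + c) = ∑ i, inner ℝ b (x i) + n * inner ℝ b c := by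
    simp only [inner_add_right, Finset.sum_add_distrib, Finset.sum_const, Finset.card_univ, Fintype.card_fin,
      nsmul_eq_mul]
  rw [fderiv_translate_of_invariant F hT x c, hT c x, sctConfigField_add_const b c x, hsum, map_add, map_add, map_add,
    map_smul, map_smul, hR b c, fderiv_apply_const_of_invariant F x hF hT, hE]
  simp only [smul_eq_mul]
  ring

end Summit.CriticalPhenomena.Ising3DConformalLimit.MoebiusLimitExistsSketchV16

end
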